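import Literature.Analysis.Complex.JensenCarlemanUpperBound
import Literature.NumberTheory.LFunctions.DirichletLogDerivDisc
import Literature.NumberTheory.LFunctions.ZetaLogDerivDisc
import Literature.NumberTheory.LFunctions.ZetaClassicalRegionBounds
import HarnessLib

/-!
# One-sided bounds for `−Re L'/L(s, χ)` and `−Re ζ'/ζ(s)` by nearby zeros (Heath-Brown's Lemma 3.1)

Topic `Literature/NumberTheory/LFunctions`. Everything in this file is PROVED (no named fact).

D. R. Heath-Brown, *Zero-free regions for Dirichlet `L`-functions, and the least prime in an
arithmetic progression*, Proc. London Math. Soc. (3) 64 (1992), **Lemma 3.1**: for `χ ≠ χ₀` mod `q`,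
`−Re L'/L(s, χ) ≤ −∑_{|1+it−ρ| ≤ δ} Re 1/(s − ρ) + (φ/2 + ε) log q` slightly to the right of `σ = 1`.
It rests on the Jensen–Carleman formula (his Lemma 3.2, the tree's
`Literature.Analysis.Complex.re_logDeriv_eq_sum_add_integral`) and a growth bound for `L(s, χ)` on a
circle. Here we record the version with the tree's crude growth bound
`‖L(z, χ)‖ ≤ q‖z‖Z` on `Re z ≥ 1/4` (`Literature.NumberTheory.LFunctions.DirichletZFR.norm_LFunction_le_of_re_ge`),
which costs the constant `2/(πR) ≤ 16/(5π) < 1.02` in front of `log q + log(|t|+2)` in place of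
Heath-Brown's `φ/2` — ample for the tree's Deuring–Heilbronn argument:

* `exists_radius_sphere_ne_zero` — in any interval of radii there is a circle about `c` free of zeros
  of a holomorphic `f` with `f(c) ≠ 0`;
* `neg_re_logDeriv_LFunction_le` — for `χ ≠ χ₀` mod `q`, `s₀ = σ₀ + it₀` with `1 < σ₀ ≤ 5/4`,
  `5/8 ≤ R ≤ 3/4` and `L(·, χ) ≠ 0` on `|z − s₀| = R`: for every finite set `T` of zeros of `L(·, χ)`
  in `|z − s₀| ≤ R`,
  `−Re L'/L(s₀, χ) ≤ −∑_{ρ ∈ T} m(ρ) Re(1/(s₀−ρ) + (ρ−s₀)/R²) + (2/πR)(log(2/(σ₀−1)) + log q + log(|t₀|+2) + log Z)`,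
  `m = DirichletDisc.zeroOrder χ`, `Z = DirichletDisc.Zc`;
* `neg_re_logDeriv_riemannZeta_le` — the same for `ζ` (applied to `ζ₁ = (s−1)ζ(s)`), with the extra
  pole term `+ Re 1/(s₀ − 1)` and `m = riemannZetaZeroOrder`.

In both, every zero term `m(ρ) Re(1/(s₀−ρ) + (ρ−s₀)/R²) = m(ρ)(σ₀−β)(|s₀−ρ|⁻² − R⁻²)` is `≥ 0`
(`re_zeroTerm_nonneg`), so `T` may be shrunk at will ("we may discard zeros from (3.7)").

## References

* D. R. Heath-Brown, Proc. London Math. Soc. (3) 64 (1992), Lemma 3.1 and its proof, (3.5)–(3.7).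
  [cite: HeathBrown1992PLMS, Lemma 3.1]
-/

noncomputable section

open Complex Set Metric Real MeromorphicOn

namespace Literature.NumberTheory.LFunctions.JensenCarlemanBounds

open Literature.Analysis.Complex Literature.Analysis.Complex.JensenCarleman

/-! ### A circle avoiding the zeros -/

/-- If `f` is holomorphic on a neighbourhood of `|z − c| ≤ R₂` with `f(c) ≠ 0` and `0 ≤ R₁ < R₂`, then
some circle `|z − c| = R`, `R₁ ≤ R ≤ R₂`, carries no zero of `f` (there are only finitely many zeros in
the disc). [folklore] -/
theorem exists_radius_sphere_ne_zero {f : ℂ → ℂ} {c : ℂ} {R₁ R₂ : ℝ} (h12 : R₁ < R₂) (hR₁ : 0 ≤ R₁)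
    (hf : AnalyticOnNhd ℂ f (closedBall c R₂)) (hc : f c ≠ 0) :
    ∃ R ∈ Icc R₁ R₂, ∀ z ∈ sphere c R, f z ≠ 0 := by
  classical
  have hR₂ : 0 < R₂ := lt_of_le_of_lt hR₁ h12
  obtain ⟨G, -, hG0, hfPG⟩ := exists_eq_prod_pow_sub_mul hR₂ le_rfl hf hc
  set S := ((divisor f (closedBall c R₂)).finiteSupport (isCompact_closedBall c R₂)).toFinset with hS
  set N : Finset ℝ := S.image fun u => ‖u - c‖ with hN
  obtain ⟨R, hRI, hRN⟩ := (Set.Icc_infinite h12).exists_notMem_finset N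
  refine ⟨R, hRI, fun z hz hfz => hRN ?_⟩
  have hzB : z ∈ closedBall c R₂ := sphere_subset_closedBall.trans (closedBall_subset_closedBall hRI.2) hz
  have hP : (∏ u ∈ S, (z - u) ^ (divisor f (closedBall c R₂) u).toNat) = 0 := by
    have h := hfPG z hzB
    rw [hfz] at h
    exact (mul_eq_zero.1 h.symm).resolve_right (hG0 z hzB)
  obtain ⟨u, huS, hu⟩ := Finset.prod_eq_zero_iff.1 hP
  have hzu : z = u := sub_eq_zero.1 (pow_eq_zero_iff'.1 hu).1
  rw [hN, Finset.mem_image]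
  refine ⟨u, huS, ?_⟩
  rw [← hzu]
  simpa [dist_eq_norm] using hz

/-! ### The zero terms -/

/-- For `ρ` in the disc `|ρ − s₀| ≤ R` with `Re ρ ≤ Re s₀` and a weight `m ≥ 0`:
`m · Re(1/(s₀ − ρ) + (ρ − s₀)/R²) ≥ 0`. [cite: HeathBrown1992PLMS, Lemma 3.1 (proof)] -/
theorem re_zeroTerm_nonneg {ρ s₀ : ℂ} {R m : ℝ} (hm : 0 ≤ m) (hρ : ‖ρ - s₀‖ ≤ R) (hre : ρ.re ≤ s₀.re) :
    0 ≤ m * (1 / (s₀ - ρ) + (ρ - s₀) / (R : ℂ) ^ 2).re :=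
  mul_nonneg hm (re_inv_sub_add_div_sq_nonneg hρ hre)

/-! ### Geometry of the circle `z = s₀ + Re^{iθ}` -/

/-- `Re(s₀ + Re^{iθ}) = Re s₀ + R cos θ`. [folklore] -/
theorem circleMap_re (c : ℂ) (R θ : ℝ) : (circleMap c R θ).re = c.re + R * Real.cos θ := by
  simp [circleMap, Complex.exp_re, Complex.mul_re]

/-- `|Im(s₀ + Re^{iθ})| ≤ |Im s₀| + R` for `R ≥ 0`. [folklore] -/
theorem abs_circleMap_im_le (c : ℂ) {R : ℝ} (hR : 0 ≤ R) (θ : ℝ) :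
    |(circleMap c R θ).im| ≤ |c.im| + R := by
  have h1 : (circleMap c R θ).im = c.im + R * Real.sin θ := by
    simp [circleMap, Complex.exp_im, Complex.mul_im]
  rw [h1]
  refine (abs_add_le _ _).trans ?_
  gcongr
  rw [abs_mul, abs_of_nonneg hR]
  calc R * |Real.sin θ| ≤ R * 1 := by gcongr; exact Real.abs_sin_le_one θ
    _ = R := mul_one R

/-! ### Dirichlet `L`-functions -/

section Dirichlet

variable {q : ℕ} [NeZero q] {χ : DirichletCharacter ℂ q}

/-- **Heath-Brown's Lemma 3.1 (crude-growth form) for `L(s, χ)`, `χ ≠ χ₀` mod `q`.** Let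
`s₀ = σ₀ + it₀` with `1 < σ₀ ≤ 5/4`, `5/8 ≤ R ≤ 3/4`, and suppose `L(z, χ) ≠ 0` on `|z − s₀| = R`. Then
for every finite set `T` of zeros of `L(·, χ)` in `|z − s₀| ≤ R`,

  `−Re L'/L(s₀, χ) ≤ −∑_{ρ ∈ T} m(ρ) Re(1/(s₀ − ρ) + (ρ − s₀)/R²)
      + (2/(πR)) (log(2/(σ₀ − 1)) + log q + log(|t₀| + 2) + log Z)`,

`m(ρ) = DirichletDisc.zeroOrder χ ρ`, `Z = DirichletDisc.Zc`. (Heath-Brown: "`−Re L'/L(s₀, χ) ≤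
−∑_{|s₀−ρ|≤R} Re(1/(s₀−ρ) − (s₀−ρ)/R²) + L{φ(1+1/k)/2 + 5ε/(πR)}` … We may discard zeros from (3.7)",
with the right half-circle bounded through `|log L| ≤ log ζ(σ₀)` and the left one through the growth
of `L(s, χ)`.) [cite: HeathBrown1992PLMS, Lemma 3.1] -/
theorem neg_re_logDeriv_LFunction_le (hχ : χ ≠ 1) {σ₀ t₀ R : ℝ} (hσ₀ : 1 < σ₀) (hσ₀' : σ₀ ≤ 5 / 4)
    (hR : 5 / 8 ≤ R) (hR' : R ≤ 3 / 4)
    (hsph : ∀ z ∈ sphere ((σ₀ : ℂ) + t₀ * I) R, χ.LFunction z ≠ 0)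
    (T : Finset ℂ) (hT : ∀ ρ ∈ T, χ.LFunction ρ = 0 ∧ ‖ρ - (σ₀ + t₀ * I)‖ ≤ R) :
    -(deriv χ.LFunction (σ₀ + t₀ * I) / χ.LFunction (σ₀ + t₀ * I)).re ≤
      -(∑ ρ ∈ T, (DirichletDisc.zeroOrder χ ρ : ℝ) *
          (1 / ((σ₀ : ℂ) + t₀ * I - ρ) + (ρ - (σ₀ + t₀ * I)) / (R : ℂ) ^ 2).re) +
        2 * (Real.log (2 / (σ₀ - 1)) + (Real.log q + Real.log (|t₀| + 2) + Real.log DirichletDisc.Zc)) /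
          (π * R) := by
  classical
  set s₀ : ℂ := (σ₀ : ℂ) + t₀ * I with hs₀
  have hR0 : 0 < R := by linarith
  have hs₀re : s₀.re = σ₀ := by simp [hs₀]
  have hs₀im : s₀.im = t₀ := by simp [hs₀]
  have han : AnalyticOnNhd ℂ χ.LFunction (closedBall s₀ R) := DirichletDisc.analyticOnNhd_LFunction χ hχ _ _
  have hc : χ.LFunction s₀ ≠ 0 :=
    DirichletCharacter.LFunction_ne_zero_of_one_le_re χ (Or.inl hχ) (by rw [hs₀re]; exact hσ₀.le)
  set D := divisor χ.LFunction (closedBall s₀ R) with hD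
  set S := (D.finiteSupport (isCompact_closedBall s₀ R)).toFinset with hS
  -- the divisor is the multiplicity
  have hDeq : ∀ u ∈ closedBall s₀ R, D u = (DirichletDisc.zeroOrder χ u : ℤ) := fun u hu => by
    rw [hD, divisor_apply han.meromorphicOn hu, DirichletDisc.meromorphicOrderAt_untop₀_eq_zeroOrder χ hχ]
  have hmemS : ∀ u, u ∈ S ↔ u ∈ closedBall s₀ R ∧ χ.LFunction u = 0 := by
    intro u
    rw [hS, Set.Finite.mem_toFinset, Function.mem_support]
    constructor
    · intro h
      have hu : u ∈ closedBall s₀ R := D.supportWithinDomain (Function.mem_support.2 h)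
      refine ⟨hu, ?_⟩
      rw [hDeq u hu] at h
      have h' : 0 < DirichletDisc.zeroOrder χ u := by
        rcases Nat.eq_zero_or_pos (DirichletDisc.zeroOrder χ u) with h0 | h0
        · exact absurd (by rw [h0]; rfl) h
        · exact h0
      exact (DirichletDisc.zeroOrder_pos_iff χ hχ u).1 h'
    · rintro ⟨hu, h0⟩
      rw [hDeq u hu]
      exact_mod_cast ((DirichletDisc.zeroOrder_pos_iff χ hχ u).2 h0).ne'
  -- zeros are to the left of `s₀`
  have hleft : ∀ u ∈ S, u.re ≤ s₀.re := by
    intro u hu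
    obtain ⟨-, h0⟩ := (hmemS u).1 hu
    rw [hs₀re]
    by_contra h
    exact DirichletCharacter.LFunction_ne_zero_of_one_le_re χ (Or.inl hχ) (by linarith) h0
  -- the right half-circle: `|log ‖L‖| ≤ log(2/(σ₀−1))`
  have hM : ∀ θ : ℝ, 0 ≤ Real.cos θ →
      |Real.log ‖χ.LFunction (circleMap s₀ R θ)‖| ≤ Real.log (2 / (σ₀ - 1)) := by
    intro θ hθ
    set z := circleMap s₀ R θ with hz
    have hzre : z.re = σ₀ + R * Real.cos θ := by rw [hz, circleMap_re, hs₀re]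
    have hz1 : 1 < z.re := by rw [hzre]; nlinarith
    have hz2 : z.re ≤ 2 := by
      rw [hzre]; nlinarith [Real.cos_le_one θ]
    have hup : ‖χ.LFunction z‖ ≤ 2 / (σ₀ - 1) := by
      have h1 : ‖χ.LFunction z‖ ≤ z.re / (z.re - 1) := by
        rw [DirichletCharacter.LFunction_eq_LSeries χ hz1]
        exact ZetaClassicalRegion.norm_LSeries_le_of_norm_le_one (fun n => DirichletCharacter.norm_le_one χ _) hz1
      refine h1.trans ?_
      rw [div_le_div_iff₀ (by linarith) (by linarith)]
      nlinarith
    have hlow : (σ₀ - 1) / 2 ≤ ‖χ.LFunction z‖ := by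
      have h1 := DirichletZFR.norm_LFunction_ge χ hz1
      refine le_trans ?_ h1
      rw [div_le_div_iff₀ (by norm_num) (by linarith)]
      nlinarith
    have hpos : 0 < ‖χ.LFunction z‖ := lt_of_lt_of_le (by positivity) hlow
    rw [abs_le]
    constructor
    · have := Real.log_le_log (by positivity) hlow
      rw [Real.log_div (by linarith) two_ne_zero] at this
      rw [Real.log_div two_ne_zero (by linarith)]
      linarith
    · exact Real.log_le_log hpos hup
  -- the left half-circle: `log ‖L‖ ≤ log q + log(|t₀|+2) + log Z`
  have hq1 : (1 : ℝ) ≤ q := by exact_mod_cast Nat.one_le_iff_ne_zero.2 (NeZero.ne q)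
  have hZ1 := DirichletDisc.one_le_Zc
  have hM' : ∀ θ : ℝ, Real.cos θ ≤ 0 →
      Real.log ‖χ.LFunction (circleMap s₀ R θ)‖ ≤ Real.log q + Real.log (|t₀| + 2) + Real.log DirichletDisc.Zc := by
    intro θ hθ
    set z := circleMap s₀ R θ with hz
    have hzre : z.re = σ₀ + R * Real.cos θ := by rw [hz, circleMap_re, hs₀re]
    have hz1 : 1 / 4 ≤ z.re := by
      rw [hzre]; nlinarith [Real.neg_one_le_cos θ]
    have hz2 : z.re ≤ 5 / 4 := by rw [hzre]; nlinarith
    have hzim : |z.im| ≤ |t₀| + R := by simpa [hz, hs₀im] using abs_circleMap_im_le s₀ hR0.le θ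
    have hznorm : ‖z‖ ≤ |t₀| + 2 := by
      have h1 : ‖z‖ ≤ |z.re| + |z.im| := Complex.norm_le_abs_re_add_abs_im z
      have h2 : |z.re| ≤ 5 / 4 := abs_le.2 ⟨by linarith, hz2⟩
      linarith
    have hup : ‖χ.LFunction z‖ ≤ q * (|t₀| + 2) * DirichletDisc.Zc := by
      refine (DirichletZFR.norm_LFunction_le_of_re_ge χ hχ hz1).trans ?_
      change (q : ℝ) * ‖z‖ * DirichletDisc.Zc ≤ q * (|t₀| + 2) * DirichletDisc.Zc
      gcongr
    have hrhs : Real.log (q * (|t₀| + 2) * DirichletDisc.Zc) =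
        Real.log q + Real.log (|t₀| + 2) + Real.log DirichletDisc.Zc := by
      rw [Real.log_mul (by positivity) (by positivity), Real.log_mul (by positivity) (by positivity)]
    rcases eq_or_lt_of_le (norm_nonneg (χ.LFunction z)) with h0 | h0
    · rw [← h0, Real.log_zero, ← hrhs]
      exact Real.log_nonneg (one_le_mul_of_one_le_of_one_le
        (one_le_mul_of_one_le_of_one_le hq1 (by linarith [abs_nonneg t₀])) hZ1)
    · rw [← hrhs]
      exact Real.log_le_log h0 hup
  -- `T ⊆ S`
  have hTS : T ⊆ S := fun ρ hρ => (hmemS ρ).2 ⟨by simpa [dist_eq_norm] using (hT ρ hρ).2, (hT ρ hρ).1⟩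
  have key := neg_re_logDeriv_le_of_bounds hR0 han hc hsph hleft hM hM' hTS
  -- convert the weights
  have hw : ∀ ρ ∈ T, ((D ρ).toNat : ℝ) = (DirichletDisc.zeroOrder χ ρ : ℝ) := by
    intro ρ hρ
    have hρB : ρ ∈ closedBall s₀ R := by simpa [dist_eq_norm] using (hT ρ hρ).2
    rw [hDeq ρ hρB, Int.toNat_natCast]
  have hsum : ∑ ρ ∈ T, ((D ρ).toNat : ℝ) * (1 / (s₀ - ρ) + (ρ - s₀) / (R : ℂ) ^ 2).re =
      ∑ ρ ∈ T, (DirichletDisc.zeroOrder χ ρ : ℝ) * (1 / (s₀ - ρ) + (ρ - s₀) / (R : ℂ) ^ 2).re :=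
    Finset.sum_congr rfl fun ρ hρ => by rw [hw ρ hρ]
  rw [hsum] at key
  exact key

end Dirichlet

/-! ### The Riemann zeta function -/

/-- **Heath-Brown's Lemma 3.1 (crude-growth form) for `ζ`**, via `ζ₁(s) = (s − 1)ζ(s)`. Let
`s₀ = σ₀ + it₀` with `1 < σ₀ ≤ 5/4`, `5/8 ≤ R ≤ 3/4`, and suppose `ζ(z) ≠ 0` on `|z − s₀| = R`. Then for
every finite set `T` of zeros of `ζ` in `|z − s₀| ≤ R`,

  `−Re ζ'/ζ(s₀) ≤ Re 1/(s₀ − 1) − ∑_{ρ ∈ T} m(ρ) Re(1/(s₀ − ρ) + (ρ − s₀)/R²)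
      + (2/(πR)) (log(2/(σ₀−1)) + log(1/(σ₀−1)) + log(|t₀|+3) + log 21 + 2 log(|t₀|+4))`,

`m(ρ) = riemannZetaZeroOrder ρ`. [cite: HeathBrown1992PLMS, Lemma 3.1 (the case of `χ₀`)] -/
theorem neg_re_logDeriv_riemannZeta_le {σ₀ t₀ R : ℝ} (hσ₀ : 1 < σ₀) (hσ₀' : σ₀ ≤ 5 / 4)
    (hR : 5 / 8 ≤ R) (hR' : R ≤ 3 / 4)
    (hsph : ∀ z ∈ sphere ((σ₀ : ℂ) + t₀ * I) R, riemannZeta z ≠ 0)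
    (T : Finset ℂ) (hT : ∀ ρ ∈ T, riemannZeta ρ = 0 ∧ ‖ρ - (σ₀ + t₀ * I)‖ ≤ R) :
    -(deriv riemannZeta (σ₀ + t₀ * I) / riemannZeta (σ₀ + t₀ * I)).re ≤
      (1 / ((σ₀ : ℂ) + t₀ * I - 1)).re -
        (∑ ρ ∈ T, (riemannZetaZeroOrder ρ : ℝ) *
          (1 / ((σ₀ : ℂ) + t₀ * I - ρ) + (ρ - (σ₀ + t₀ * I)) / (R : ℂ) ^ 2).re) +
        2 * ((Real.log (2 / (σ₀ - 1)) + Real.log (1 / (σ₀ - 1)) + Real.log (|t₀| + 3)) +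
            (Real.log 21 + 2 * Real.log (|t₀| + 4))) / (π * R) := by
  classical
  set s₀ : ℂ := (σ₀ : ℂ) + t₀ * I with hs₀
  have hR0 : 0 < R := by linarith
  have hs₀re : s₀.re = σ₀ := by simp [hs₀]
  have hs₀im : s₀.im = t₀ := by simp [hs₀]
  have han : AnalyticOnNhd ℂ riemannZeta₁ (closedBall s₀ R) := fun z _ =>
    differentiable_riemannZeta₁.analyticAt z
  have hs₀1 : s₀ ≠ 1 := fun h => by
    have := congrArg Complex.re h; rw [hs₀re] at this; simp at this; linarith
  have hζs₀ : riemannZeta s₀ ≠ 0 := riemannZeta_ne_zero_of_one_le_re (by rw [hs₀re]; exact hσ₀.le)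
  have hc : riemannZeta₁ s₀ ≠ 0 := by
    rw [riemannZeta₁_eq_mul hs₀1]; exact mul_ne_zero (sub_ne_zero.2 hs₀1) hζs₀
  -- points of the closed disc are `≠ 1`? No: `1` may lie inside; but zeros of `ζ₁` are zeros of `ζ`.
  have hsph₁ : ∀ z ∈ sphere s₀ R, riemannZeta₁ z ≠ 0 := fun z hz h =>
    hsph z hz (riemannZeta_eq_zero_of_riemannZeta₁ h)
  set D := divisor riemannZeta₁ (closedBall s₀ R) with hD
  set S := (D.finiteSupport (isCompact_closedBall s₀ R)).toFinset with hS
  have hDeq : ∀ u ∈ closedBall s₀ R, u ≠ 1 → D u = riemannZetaZeroOrder u := fun u hu hu1 => by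
    rw [hD, divisor_apply han.meromorphicOn hu, meromorphicOrderAt_riemannZeta₁_eq hu1, riemannZetaZeroOrder]
  have hmemS : ∀ u, u ∈ S → u ∈ closedBall s₀ R ∧ riemannZeta₁ u = 0 := by
    intro u hu
    rw [hS, Set.Finite.mem_toFinset, Function.mem_support] at hu
    have huB : u ∈ closedBall s₀ R := D.supportWithinDomain (Function.mem_support.2 hu)
    refine ⟨huB, ?_⟩
    rw [hD, divisor_apply han.meromorphicOn huB, (han u huB).meromorphicOrderAt_eq] at hu
    by_contra hne
    apply hu
    rw [(han u huB).analyticOrderAt_eq_zero.2 hne]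
    simp
  have hleft : ∀ u ∈ S, u.re ≤ s₀.re := by
    intro u hu
    obtain ⟨-, h0⟩ := hmemS u hu
    have hz := riemannZeta_eq_zero_of_riemannZeta₁ h0
    rw [hs₀re]
    by_contra h
    exact riemannZeta_ne_zero_of_one_le_re (by linarith) hz
  -- right half: `|log ‖ζ₁‖| ≤ log(2/(σ₀−1)) + log(1/(σ₀−1)) + log(|t₀|+3)`
  have hM : ∀ θ : ℝ, 0 ≤ Real.cos θ → |Real.log ‖riemannZeta₁ (circleMap s₀ R θ)‖| ≤
      Real.log (2 / (σ₀ - 1)) + Real.log (1 / (σ₀ - 1)) + Real.log (|t₀| + 3) := by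
    intro θ hθ
    set z := circleMap s₀ R θ with hz
    have hzre : z.re = σ₀ + R * Real.cos θ := by rw [hz, circleMap_re, hs₀re]
    have hz1 : 1 < z.re := by rw [hzre]; nlinarith
    have hz2 : z.re ≤ 2 := by rw [hzre]; nlinarith [Real.cos_le_one θ]
    have hzne : z ≠ 1 := fun h => by have := congrArg Complex.re h; simp at this; linarith
    have hzim : |z.im| ≤ |t₀| + R := by simpa [hz, hs₀im] using abs_circleMap_im_le s₀ hR0.le θ
    -- `ζ(z)`
    have hup : ‖riemannZeta z‖ ≤ 2 / (σ₀ - 1) := by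
      refine (ZetaClassicalRegion.norm_riemannZeta_le_of_one_lt_re hz1).trans ?_
      rw [div_le_div_iff₀ (by linarith) (by linarith)]
      nlinarith
    have hlow : (σ₀ - 1) / 2 ≤ ‖riemannZeta z‖ := by
      refine le_trans ?_ (ZetaClassicalRegion.norm_riemannZeta_ge_of_one_lt_re hz1)
      rw [div_le_div_iff₀ (by norm_num) (by linarith)]
      nlinarith
    have hζpos : 0 < ‖riemannZeta z‖ := lt_of_lt_of_le (by positivity) hlow
    -- `z − 1`
    have h1up : ‖z - 1‖ ≤ |t₀| + 3 := by
      have h1 : ‖z - 1‖ ≤ |(z - 1).re| + |(z - 1).im| := Complex.norm_le_abs_re_add_abs_im _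
      have h2 : |(z - 1).re| ≤ 1 := by
        rw [Complex.sub_re, Complex.one_re]; exact abs_le.2 ⟨by linarith, by linarith⟩
      have h3 : |(z - 1).im| ≤ |t₀| + R := by rw [Complex.sub_im, Complex.one_im, sub_zero]; exact hzim
      linarith
    have h1low : σ₀ - 1 ≤ ‖z - 1‖ := by
      have := Complex.abs_re_le_norm (z - 1)
      rw [Complex.sub_re, Complex.one_re] at this
      have h4 : σ₀ - 1 ≤ z.re - 1 := by rw [hzre]; nlinarith
      exact h4.trans ((le_abs_self _).trans this)
    have h1pos : 0 < ‖z - 1‖ := lt_of_lt_of_le (by linarith) h1low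
    -- assemble
    rw [riemannZeta₁_eq_mul hzne, norm_mul, Real.log_mul h1pos.ne' hζpos.ne', abs_le]
    have e1 := Real.log_le_log h1pos h1up
    have e2 := Real.log_le_log (by linarith : (0:ℝ) < σ₀ - 1) h1low
    have e3 := Real.log_le_log hζpos hup
    have e4 := Real.log_le_log (by positivity) hlow
    rw [Real.log_div (by linarith) two_ne_zero] at e4
    have e5 : Real.log (2 / (σ₀ - 1)) = Real.log 2 - Real.log (σ₀ - 1) := Real.log_div two_ne_zero (by linarith)
    have e6 : Real.log (1 / (σ₀ - 1)) = -Real.log (σ₀ - 1) := by rw [one_div, Real.log_inv]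
    have e7 : 0 ≤ Real.log (|t₀| + 3) := Real.log_nonneg (by linarith [abs_nonneg t₀])
    have e8 : Real.log (σ₀ - 1) ≤ Real.log (1 / 4) := Real.log_le_log (by linarith) (by linarith)
    have e9 : Real.log (1 / 4 : ℝ) < 0 := Real.log_neg (by norm_num) (by norm_num)
    have e10 : 0 < Real.log 2 := Real.log_pos (by norm_num)
    constructor <;> linarith
  -- left half: `log ‖ζ₁‖ ≤ log 21 + 2 log(|t₀|+4)`
  have hM' : ∀ θ : ℝ, Real.cos θ ≤ 0 →
      Real.log ‖riemannZeta₁ (circleMap s₀ R θ)‖ ≤ Real.log 21 + 2 * Real.log (|t₀| + 4) := by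
    intro θ _
    set z := circleMap s₀ R θ with hz
    have hzball : z ∈ closedBall (2 + (t₀ : ℂ) * I) (39 / 20) := by
      rw [mem_closedBall, dist_eq_norm]
      have h1 : z - (2 + t₀ * I) = (((σ₀ - 2 : ℝ) : ℂ)) + (z - s₀) := by
        rw [hs₀]; push_cast; ring
      have h2 : ‖z - s₀‖ = R := by simp [hz, abs_of_pos hR0]
      rw [h1]
      refine (norm_add_le _ _).trans ?_
      rw [h2, Complex.norm_real, Real.norm_eq_abs, abs_of_nonpos (by linarith)]
      linarith
    have hup := norm_riemannZeta₁_le_of_mem_closedBall t₀ hzball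
    have hrhs : Real.log (21 * (|t₀| + 4) ^ 2) = Real.log 21 + 2 * Real.log (|t₀| + 4) := by
      rw [Real.log_mul (by norm_num) (by positivity), Real.log_pow]; push_cast; ring
    rcases eq_or_lt_of_le (norm_nonneg (riemannZeta₁ z)) with h0 | h0
    · rw [← h0, Real.log_zero, ← hrhs]
      exact Real.log_nonneg (by nlinarith [abs_nonneg t₀])
    · rw [← hrhs]; exact Real.log_le_log h0 hup
  -- `T ⊆ S`
  have hT1 : ∀ ρ ∈ T, ρ ≠ 1 := fun ρ hρ h => by
    have := (hT ρ hρ).1; rw [h] at this; exact riemannZeta_ne_zero_of_one_le_re (by simp) this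
  have hTS : T ⊆ S := by
    intro ρ hρ
    have hρB : ρ ∈ closedBall s₀ R := by simpa [dist_eq_norm] using (hT ρ hρ).2
    rw [hS, Set.Finite.mem_toFinset, Function.mem_support, hDeq ρ hρB (hT1 ρ hρ)]
    exact ((riemannZetaZeroOrder_pos_iff (hT1 ρ hρ)).2 (hT ρ hρ).1).ne'
  have key := neg_re_logDeriv_le_of_bounds hR0 han hc hsph₁ hleft hM hM' hTS
  -- weights
  have hsum : ∑ ρ ∈ T, ((D ρ).toNat : ℝ) * (1 / (s₀ - ρ) + (ρ - s₀) / (R : ℂ) ^ 2).re =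
      ∑ ρ ∈ T, (riemannZetaZeroOrder ρ : ℝ) * (1 / (s₀ - ρ) + (ρ - s₀) / (R : ℂ) ^ 2).re := by
    refine Finset.sum_congr rfl fun ρ hρ => ?_
    have hρB : ρ ∈ closedBall s₀ R := by simpa [dist_eq_norm] using (hT ρ hρ).2
    rw [hDeq ρ hρB (hT1 ρ hρ)]
    have h0 : 0 ≤ riemannZetaZeroOrder ρ := (riemannZetaZeroOrder_pos_iff (hT1 ρ hρ)).2 (hT ρ hρ).1 |>.le
    congr 1
    rw [show ((riemannZetaZeroOrder ρ).toNat : ℝ) = (((riemannZetaZeroOrder ρ).toNat : ℤ) : ℝ) by norm_cast,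
      Int.toNat_of_nonneg h0]
  rw [hsum] at key
  -- `ζ₁'/ζ₁ = ζ'/ζ + 1/(s−1)`
  have hld : deriv riemannZeta₁ s₀ / riemannZeta₁ s₀ = deriv riemannZeta s₀ / riemannZeta s₀ + (s₀ - 1)⁻¹ := by
    have h := logDeriv_riemannZeta_eq hs₀1 hζs₀
    rw [logDeriv_apply, logDeriv_apply] at h
    rw [h]; ring
  rw [hld, Complex.add_re] at key
  have : ((s₀ - 1)⁻¹).re = (1 / (s₀ - 1)).re := by rw [one_div]
  linarith

end Literature.NumberTheory.LFunctions.JensenCarlemanBounds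

end
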